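import Literature.Computability.Cryptography.WordRAMForward2
import HarnessLib

/-!
# The word RAM — inline simulation with query forwarding, III: the composed reduction

The oracle machine `SIMF M k M_B k_B` behind the transitivity of fine-grained reductions
(V. Vassilevska Williams–R. Williams, J. ACM 65 (2018), §3, Prop. 1, proof p. 27:11; VVW ICM
2018, Prop. 2.2): the outer reduction `M` (to `B`, word-size constant `k`) with every oracle call
answered by an inline run of the inner reduction `M_B` (to `D`, word-size constant `k_B`) whose own
oracle calls are forwarded to the real `D`-oracle — prologue (`…WordRAMInline1.run_PRO`), the
step-by-step emulation of `M` (`…WordRAMEmulator.emu_step` for ordinary instructions,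
`…WordRAMForward2.run_QBF` for `query`), epilogue (`run_EPI`). Specification `run_SIMF`: run with
the `D`-oracle `O`, it outputs what `M` outputs under the oracle "`M_B` under `O`", its query log is
the concatenation of the `D`-query logs of the inline runs, and the cost is
`proCost |x| W + 38 · t + Σ_{queries q of M} (qbCost |q| W (s q) |O_B q| + Σ_{D-queries of M_B on q}
qfCost) + epiCost |output|` — the accounting of loc. cit. ("the running time … is
`n^{q-δ} + Σᵢ |xᵢ|^{q-δ'}`"; the `D`-ledger is the sum of the inner ledgers).

## References

* V. Vassilevska Williams, R. R. Williams, *Subcubic equivalences between path, matrix, and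
  triangle problems*, J. ACM 65 (2018), Art. 27, §3, Prop. 1 (p. 27:10, proof p. 27:11).
  doi:10.1145/3186893
* V. Vassilevska Williams, *On some fine-grained questions in algorithms and complexity*,
  Proc. ICM 2018, §2 (Def. 2.1, Prop. 2.2).
-/

namespace Literature.Computability.Cryptography.WordRAM

open StateTransition

namespace Inline

/-! ## The composed machine -/

/-- **The composed reduction**: the outer reduction `M` (word-size constant `k`) with the inner
reduction `M_B` (word-size constant `k_B`) inlined and its queries forwarded: prologue, the
compiled `M` whose `query` blocks are the query blocks with forwarding `QBF M_B k_B`, epilogue.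
[folklore] -/
def SIMF (M : Program) (k : ℕ) (MB : Program) (kB : ℕ) : Program :=
  PRO k ++ compile LM (qlenMF MB) M 88 (QBF MB kB) ++ EPI (exitPos LM (qlenMF MB) M 88)

section structural

/-- Straight-line operations are not `rand`. [folklore] -/
theorem norand_of_mem_map {ops : List OpSpec} {I : Instr} (h : I ∈ ops.map OpSpec.toInstr) :
    I.isRand = false :=
  (plain_of_mem_map h).1

/-- Compiled code has no `rand` if the query blocks have none. [folklore] -/
theorem norand_of_mem_compile {L : Layout} {qlen : ℕ} {M : Program} {base : ℕ}
    {qb : ℕ → Operand → Operand → Operand → List Instr}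
    (hqb : ∀ pos qa ql aa, ∀ I ∈ qb pos qa ql aa, I.isRand = false) {I : Instr}
    (h : I ∈ compile L qlen M base qb) : I.isRand = false := by
  simp only [compile, List.mem_flatten, List.mem_map, List.mem_range] at h
  obtain ⟨_, ⟨i, -, rfl⟩, hI⟩ := h
  simp only [blkAt] at hI
  split at hI
  · exact norand_of_mem_map hI
  · simp only [List.mem_singleton] at hI; subst hI; rfl
  · simp only [List.mem_append, List.mem_singleton] at hI
    rcases hI with hI | rfl
    · exact norand_of_mem_map hI
    · rfl
  · simp only [List.mem_singleton] at hI; subst hI; rfl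
  · simp only [List.mem_singleton] at hI; subst hI; rfl
  · exact hqb _ _ _ _ _ hI
  · simp at hI

/-- The forwarding block has no `rand`. [folklore] -/
theorem norand_of_mem_QF {pos : ℕ} {qa ql aa : Operand} {I : Instr} (h : I ∈ QF pos qa ql aa) :
    I.isRand = false := by
  simp only [QF, List.mem_append, List.mem_singleton] at h
  rcases h with ((((h | h) | h) | rfl) | h) | h
  exacts [norand_of_mem_map h, norand_of_mem_map h, (plain_of_mem_loopBlock h).1, rfl,
    norand_of_mem_map h, (plain_of_mem_loopBlock h).1]

/-- The query block with forwarding has no `rand`. [folklore] -/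
theorem norand_of_mem_QBF {MB : Program} {kB pos : ℕ} {qa ql aa : Operand} {I : Instr}
    (h : I ∈ QBF MB kB pos qa ql aa) : I.isRand = false := by
  simp only [QBF, List.mem_append] at h
  rcases h with (((((((h | h) | h) | h) | h) | h) | h) | h) | h
  exacts [norand_of_mem_map h, norand_of_mem_map h, (plain_of_mem_widthCode h).1, norand_of_mem_map h,
    norand_of_mem_map h, (plain_of_mem_loopBlock h).1,
    norand_of_mem_compile (fun _ _ _ _ _ hI => norand_of_mem_QF hI) h,
    norand_of_mem_map h, (plain_of_mem_loopBlock h).1]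

/-- **The composed reduction is deterministic.** [folklore] -/
theorem SIMF_isDeterministic (M : Program) (k : ℕ) (MB : Program) (kB : ℕ) :
    (SIMF M k MB kB).IsDeterministic := by
  intro I h
  simp only [SIMF, List.mem_append] at h
  rcases h with (h | h) | h
  exacts [(plain_of_mem_PRO h).1, norand_of_mem_compile (fun _ _ _ _ _ hI => norand_of_mem_QBF hI) h,
    (plain_of_mem_EPI h).1]

/-- The query blocks with forwarding have length `qlenMF MB`. [folklore] -/
theorem QBF_length' (MB : Program) (kB : ℕ) :
    ∀ pos (qa ql aa : Operand), (QBF MB kB pos qa ql aa).length = qlenMF MB :=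
  fun pos qa ql aa => QBF_length MB kB pos qa ql aa

/-- Placement of the three parts of the composed reduction. [folklore] -/
theorem codeAt_SIMF (M : Program) (k : ℕ) (MB : Program) (kB : ℕ) :
    CodeAt (SIMF M k MB kB) 0 (PRO k) ∧
      CodeAt (SIMF M k MB kB) 88 (compile LM (qlenMF MB) M 88 (QBF MB kB)) ∧
      CodeAt (SIMF M k MB kB) (exitPos LM (qlenMF MB) M 88) (EPI (exitPos LM (qlenMF MB) M 88)) := by
  have h := codeAt_self (SIMF M k MB kB)
  conv at h => arg 3; rw [SIMF]
  obtain ⟨h12, h3⟩ := codeAt_append_iff.1 h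
  obtain ⟨h1, h2⟩ := codeAt_append_iff.1 h12
  simp only [PRO_length, Nat.zero_add, List.length_append] at h2 h3
  have hlen := length_compile (L := LM) (qlen := qlenMF MB) (M := M) (base := 88) (qb := QBF MB kB)
    (QBF_length' MB kB)
  rw [show 88 + (compile LM (qlenMF MB) M 88 (QBF MB kB)).length = exitPos LM (qlenMF MB) M 88 by omega] at h3
  exact ⟨h1, h2, h3⟩

end structural

/-! ## The simulation invariant and one step of the outer reduction -/

section sim

variable {M MB : Program} {k kB W ws VT V VB : ℕ} {P : Program}

/-- The cost charged to a query `q` of the outer reduction: its query block, with `s q` steps of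
the inner reduction, the answer `OB q`, and the forwarding blocks of the `D`-queries `Dq q` the
inner reduction makes on `q`. [folklore] -/
def chargeB (W : ℕ) (O OB : List ℕ → List ℕ) (s : List ℕ → ℕ) (Dq : List ℕ → List (List ℕ))
    (q : List ℕ) : ℕ :=
  qbCost q.length W (s q) (OB q).length + ((Dq q).map (chargeF O)).sum

/-- **The simulation invariant** between a configuration `d` of the outer reduction `M` (run at
word size `ws` with the `B`-oracle) and a configuration `e` of the composed reduction (word size
`W`): the emulation relation of `M`, the `B`-side between calls at generation `|d.queries|`, the
generation register, and the query log of `e` = the `D`-queries of the inline runs so far.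
[folklore] -/
def SimInvF (W ws VT : ℕ) (M MB : Program) (Dq : List ℕ → List (List ℕ)) (d e : Cfg) : Prop :=
  ERel LM (EM W ws) VT M 88 (qlenMF MB) d e ∧ BPre W d.queries.length e.mem ∧
    e.mem 10 = d.queries.length ∧ e.queries = (d.queries.map Dq).flatten

/-- **One step of the outer reduction, simulated.** From `SimInvF d e` with `d` `V`-bounded, one
source step `d → d'` (word size `ws`, oracle `OB`) is matched by a target run (oracle `O`) to some
`e'` with `SimInvF d' e'`; an ordinary instruction costs at most `cstep`, a `query q` additionally
`chargeB W O OB s Dq q`, provided the inner reduction, run with `O` on `q` at word size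
`k_B · inputWidth q`, halts within `s q` steps with output `OB q` and query log `Dq q`, all of whose
answers have length `≤ VB`. [folklore] -/
theorem sim_stepF (hcode : CodeAt P 88 (compile LM (qlenMF MB) M 88 (QBF MB kB)))
    (hws : ws < W) (hVT : VT + 1 = 2 ^ W)
    (hdet : M.IsDeterministic) (hBdet : MB.IsDeterministic)
    (hMV : Program.maxConst M ≤ V) (hV1 : 1 ≤ V) (hVQ : 2 * V + 42 ≤ Qv W - 40)
    (hkB : kB * Nat.size V < W) (hVB : 2 ^ (kB * Nat.size V) ≤ VB) (hMBc : Program.maxConst MB ≤ VB)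
    (hVBQ : 2 * VB + 2 ≤ Qv W)
    {O OB : List ℕ → List ℕ} {s : List ℕ → ℕ} {Dq : List ℕ → List (List ℕ)} {d d' e : Cfg}
    (hinv : SimInvF W ws VT M MB Dq d e)
    (hdm : MemLE V d.mem) (hstep : step M ws OB zeroCoins d = some d')
    (hgT : d.queries.length + 1 ≤ VT)
    (hO : ∀ q ∈ d'.queries, (OB q).length ≤ V)
    (hMB : ∀ q ∈ d'.queries, ∃ cB, HaltsWithin MB (kB * inputWidth q) O zeroCoins q (s q) cB ∧
      readOut cB.mem = OB q ∧ cB.queries = Dq q ∧ ∀ q' ∈ cB.queries, (O q').length ≤ VB)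
    (ρ' : ℕ → ℕ) :
    ∃ n e', run P W O ρ' n e = some e' ∧ SimInvF W ws VT M MB Dq d' e' ∧
      n + (d.queries.map (chargeB W O OB s Dq)).sum ≤ cstep + (d'.queries.map (chargeB W O OB s Dq)).sum := by
  have hW : 8 ≤ W := eight_le_of_Qv (by omega)
  have hQ := Qv_ge hW
  have h4Q := four_mul_Qv (show 2 ≤ W by omega)
  have hVT1 : 1 ≤ VT := by
    have : 2 ^ 8 ≤ 2 ^ W := Nat.pow_le_pow_right (by norm_num) hW
    omega
  have hVVT : V ≤ VT := by omega
  have hOKM := envOK_M hW hws.le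
  have hqb : ∀ pos qa ql aa, (QBF MB kB pos qa ql aa).length = qlenMF MB := QBF_length' MB kB
  obtain ⟨hrel, hpre, h10, hqlog⟩ := hinv
  -- is the source step a query?
  by_cases hnq : ∀ i qa ql aa, d.pc = some i → M[i]? ≠ some (.query qa ql aa)
  · -- ordinary instruction: the emulator step
    obtain ⟨n, hn, e', hrun, hrel', -, hqu, hfr⟩ := emu_step (L := LM) (E := EM W ws) hOKM hVT hVT1
      (LM_regs_le (by omega)) hqb hcode hdet hMV (by simp only [EM_Q]; omega) hVVT O ρ' hrel hdm
      hstep hnq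
    have hqs : d'.queries = d.queries := by
      rcases step_queries hstep with h | ⟨i, qa, ql, aa, hpc, hMi, -⟩
      · exact h
      · exact absurd hMi (hnq i qa ql aa hpc)
    refine ⟨n, e', hrun, ⟨hrel', ?_, ?_, ?_⟩, by rw [hqs]; omega⟩
    · rw [hqs]
      exact hpre.of_frame fun c hc => hfr c fun hf => by have := foot_M hW hf; omega
    · rw [hqs, hfr 10 fun hf => by have := foot_M hW hf; omega, h10]
    · rw [hqs, hqu, hqlog]
  · -- a query: the query block with forwarding
    simp only [not_forall, not_not, exists_prop] at hnq
    obtain ⟨i, qa, ql, aa, hpc, hMi⟩ := hnq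
    have hi : i < M.length := (List.getElem?_eq_some_iff.1 hMi).1
    rw [step_query hpc hMi] at hstep
    simp only [Option.some.injEq] at hstep
    subst hstep
    simp only at hO hMB ⊢
    have hqmem : readSeg d.mem (qa.read d.mem) (ql.read d.mem) ∈
        d.queries ++ [readSeg d.mem (qa.read d.mem) (ql.read d.mem)] :=
      List.mem_append_right _ (List.mem_singleton_self _)
    obtain ⟨cB, hrunB, houtB, hqB, hOD⟩ := hMB _ hqmem
    have hoV := hO _ hqmem
    -- constants of the query instruction
    have hIc : (Instr.query qa ql aa).maxConst ≤ V := le_trans (Instr.maxConst_le_of_getElem? hMi) hMV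
    simp only [Instr.maxConst, max_le_iff] at hIc
    -- placement of the query block
    have hblk := codeAt_blkAt (L := LM) (qlen := qlenMF MB) (base := 88) (qb := QBF MB kB) hqb hcode hi
    simp only [blkAt, hMi] at hblk
    have hpce : e.pc = some (bstart LM (qlenMF MB) M 88 i) := by rw [hrel.pc, hpc]; rfl
    obtain ⟨n, hn, e', hrun, hpc', hM', ⟨wsB, hB'⟩, h10', -, hqu'⟩ := run_QBF (W := W) (ws := ws) (VT := VT)
      (V := V) hblk hws hVT hBdet hpce ⟨hrel.inv, hrel.agree⟩ hpre h10 hdm hIc.1 hIc.2.1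
      hIc.2.2 hV1 hrunB houtB hoV hVQ hgT hkB hVB hMBc hVBQ hOD ρ'
    refine ⟨n, e', hrun, ⟨⟨?_, hM'.2, hM'.1⟩, ?_, ?_, ?_⟩, ?_⟩
    · rw [hpc']
      simp only [Option.getD_some]
      rw [bstart_succ hi]
      simp [blkLenAt, hMi, blkLen]
    · simpa only [List.length_append, List.length_singleton] using hB'.bpre
    · simpa only [List.length_append, List.length_singleton] using h10'
    · rw [hqu', hqlog, hqB, List.map_append, List.flatten_append, List.map_cons, List.map_nil,
        List.flatten_cons, List.flatten_nil, List.append_nil]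
    · simp only [List.map_append, List.map_cons, List.map_nil, List.sum_append, List.sum_cons,
        List.sum_nil, Nat.add_zero, chargeB, readSeg_length]
      rw [hqB] at hn
      have : cstep = 38 := rfl
      omega

/-- **The run of the outer reduction, simulated.** `n` source steps from `SimInvF d₀ e₀` (source
`V`-bounded, `2 ^ ws - 1 ≤ V`) are matched by a target run (oracle `O`) to some `en` with
`SimInvF dn en`, at cost `cstep · n` plus the charges of the queries made, provided every query in
the final log has a short answer that the inner reduction computes under `O` with a logged set of
short-answered `D`-queries. [folklore] -/
theorem sim_runF (hcode : CodeAt P 88 (compile LM (qlenMF MB) M 88 (QBF MB kB)))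
    (hws : ws < W) (hVT : VT + 1 = 2 ^ W)
    (hdet : M.IsDeterministic) (hBdet : MB.IsDeterministic)
    (hMV : Program.maxConst M ≤ V) (hV1 : 1 ≤ V) (hwsV : 2 ^ ws - 1 ≤ V) (hVQ : 2 * V + 42 ≤ Qv W - 40)
    (hkB : kB * Nat.size V < W) (hVB : 2 ^ (kB * Nat.size V) ≤ VB) (hMBc : Program.maxConst MB ≤ VB)
    (hVBQ : 2 * VB + 2 ≤ Qv W)
    {O OB : List ℕ → List ℕ} {s : List ℕ → ℕ} {Dq : List ℕ → List (List ℕ)} {d₀ e₀ : Cfg}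
    (hinv : SimInvF W ws VT M MB Dq d₀ e₀) (hdm : MemLE V d₀.mem) (ρ' : ℕ → ℕ) :
    ∀ (n : ℕ) {dn : Cfg}, run M ws OB zeroCoins n d₀ = some dn → dn.queries.length + 1 ≤ VT →
      (∀ q ∈ dn.queries, (OB q).length ≤ V) →
      (∀ q ∈ dn.queries, ∃ cB, HaltsWithin MB (kB * inputWidth q) O zeroCoins q (s q) cB ∧
        readOut cB.mem = OB q ∧ cB.queries = Dq q ∧ ∀ q' ∈ cB.queries, (O q').length ≤ VB) →
      ∃ m en, run P W O ρ' m e₀ = some en ∧ SimInvF W ws VT M MB Dq dn en ∧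
        m + (d₀.queries.map (chargeB W O OB s Dq)).sum ≤
          cstep * n + (dn.queries.map (chargeB W O OB s Dq)).sum
  | 0, dn, h, _, _, _ => by
      simp only [run_zero, Option.some.injEq] at h
      subst h
      exact ⟨0, e₀, rfl, hinv, by simp⟩
  | n + 1, dn, h, hg, hO, hMB => by
      rw [run_add, Option.bind_eq_some_iff] at h
      obtain ⟨dm, hdm', hlast⟩ := h
      rw [run_one] at hlast
      have hpre := step_queries_prefix hlast
      have hlen := hpre.length_le
      obtain ⟨m, em, hrun, hinvm, hcost⟩ := sim_runF hcode hws hVT hdet hBdet hMV hV1 hwsV hVQ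
        hkB hVB hMBc hVBQ hinv hdm ρ' n hdm' (by omega) (fun q hq => hO q (hpre.subset hq))
        fun q hq => hMB q (hpre.subset hq)
      have hmemm : MemLE V dm.mem :=
        run_memLE_of_queries hwsV hV1 hMV n hdm hdm' fun q hq => hO q (hpre.subset hq)
      obtain ⟨m', e', hrun', hinv', hcost'⟩ := sim_stepF hcode hws hVT hdet hBdet hMV hV1 hVQ
        hkB hVB hMBc hVBQ hinvm hmemm hlast (by omega) hO hMB ρ'
      exact ⟨m + m', e', run_add_of_run _ _ _ _ hrun hrun', hinv', by rw [Nat.mul_succ]; omega⟩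

/-! ## The whole composed reduction -/

/-- **Specification of the composed reduction.** Let the deterministic outer reduction `M`, run on
`x` at word size `k · inputWidth x` with the oracle `OB`, halt within `t` steps in `cM`; let every
query `q` in its log have an answer `OB q` of length `≤ V` which the deterministic inner reduction
`M_B`, run *with the oracle* `O` at word size `k_B · inputWidth q`, outputs within `s q` steps
with query log `Dq q`, all answers `O q'`, `q' ∈ Dq q`, having length `≤ VB`. Then, under the
numeric side conditions, the composed reduction run on `x` at word size `W` with the oracle `O`
(any coins) halts within `simCost |x| W t (Σ_q chargeB q) |readOut cM.mem|` steps with the same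
output as `M`, and its query log is the concatenation of the `Dq q` over the queries `q` of `M`, in
order (V. Vassilevska Williams–R. Williams 2018, proof of Prop. 1). [folklore] -/
theorem run_SIMF (hdet : M.IsDeterministic) (hBdet : MB.IsDeterministic)
    {x : List ℕ} (hw : inputWidth x ≤ W) (hk : k * inputWidth x < W)
    (hL : x.length + 83 ≤ Qv W)
    (hMV : Program.maxConst M ≤ V) (hV1 : 1 ≤ V) (hwsV : 2 ^ (k * inputWidth x) - 1 ≤ V)
    (hVQ : 2 * V + 121 ≤ Qv W - 40)
    (hkB : kB * Nat.size V < W) (hVB : 2 ^ (kB * Nat.size V) ≤ VB) (hMBc : Program.maxConst MB ≤ VB)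
    (hVBQ : 2 * VB + 2 ≤ Qv W)
    {O OB : List ℕ → List ℕ} {t : ℕ} {cM : Cfg} (hM : HaltsWithin M (k * inputWidth x) OB zeroCoins x t cM)
    (ht : t + 2 ≤ 2 ^ W) (hO : ∀ q ∈ cM.queries, (OB q).length ≤ V) {s : List ℕ → ℕ}
    {Dq : List ℕ → List (List ℕ)}
    (hMB : ∀ q ∈ cM.queries, ∃ cB, HaltsWithin MB (kB * inputWidth q) O zeroCoins q (s q) cB ∧
      readOut cB.mem = OB q ∧ cB.queries = Dq q ∧ ∀ q' ∈ cB.queries, (O q').length ≤ VB)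
    (ρ' : ℕ → ℕ) :
    ∃ n c', run (SIMF M k MB kB) W O ρ' n (init W x) = some c' ∧ c'.pc = none ∧
      readOut c'.mem = readOut cM.mem ∧ c'.queries = (cM.queries.map Dq).flatten ∧
      n ≤ simCost x.length W t ((cM.queries.map (chargeB W O OB s Dq)).sum) (readOut cM.mem).length := by
  have hW : 8 ≤ W := eight_le_of_Qv (by omega)
  have hQ := Qv_ge hW
  have h4Q := four_mul_Qv (show 2 ≤ W by omega)
  set ws := k * inputWidth x with hws
  set VT := 2 ^ W - 1 with hVTdef
  have hVT : VT + 1 = 2 ^ W := by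
    have : 1 ≤ 2 ^ W := Nat.one_le_two_pow; omega
  obtain ⟨cPRO, cCMP, cEPI⟩ := codeAt_SIMF M k MB kB
  -- the prologue
  obtain ⟨n₁, hn₁, mem₁, r₁, hreg, hzero, e4, e5, e6, e7, e8, e9, e10, hword⟩ :=
    run_PRO (P := SIMF M k MB kB) (O := O) (ρ := ρ') cPRO hw hk hL
  -- the initial invariant
  have hst : StampLE (EM W ws) mem₁ := fun a ha => by
    simp only [EM_Sv, EM_Gv]; rw [hzero _ (by omega)]
  have hT₁ : MemLE VT mem₁ := fun a => by have := hword a; omega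
  have hpre₁ : BPre W 0 mem₁ := ⟨e8, e9, fun a ha => by rw [hzero _ (by omega)]⟩
  have hinv₀ : SimInvF W ws VT M MB Dq (init ws x) ⟨some 88, mem₁, 0, []⟩ := by
    refine ⟨⟨?_, fun a ha => ?_, ⟨⟨e4, e5, e6, e7⟩, hst, hT₁⟩⟩, by simpa using hpre₁, by simpa using e10,
      by simp⟩
    · simp [bstart_zero]
    · simp only [EM_Q] at ha
      show edec (EM W ws) mem₁ a = (init ws x).mem a
      rw [edec_M_eq hst ha, hreg a ha]
  -- the run of the reduction
  obtain ⟨nM, hnM, hrunM, hstepM⟩ := hM.exists_run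
  have hhalt : cM.pc = none := (step_eq_none_iff _ _ _ _ _).1 hstepM
  have hqlen : cM.queries.length ≤ nM := by simpa using run_queries_length nM hrunM
  obtain ⟨n₂, e₂, r₂, ⟨hrel₂, hpre₂, -, hq₂⟩, hcost₂⟩ := sim_runF (P := SIMF M k MB kB) cCMP hk hVT hdet
    hBdet hMV hV1 hwsV (by omega) hkB hVB hMBc hVBQ hinv₀ (init_memLE ws x hwsV) ρ' nM hrunM
    (by omega) hO hMB
  have hmemM : MemLE V cM.mem := run_memLE_of_queries hwsV hV1 hMV nM (init_memLE ws x hwsV) hrunM hO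
  -- the epilogue
  have hpc₂ : e₂.pc = some (exitPos LM (qlenMF MB) M 88) := by
    rw [hrel₂.pc, hhalt, Option.getD_none, exitPos]
  have h40 : e₂.mem 40 = cM.mem 0 := by
    have := hrel₂.agree 0 (by simp only [EM_Q]; omega)
    rwa [edec_M_eq hrel₂.inv.stamp (by omega), Nat.add_zero] at this
  have hℓ : cM.mem 0 ≤ V := hmemM 0
  obtain ⟨n₃, hn₃, c', r₃, hpc₃, -, hq₃, h0, hout⟩ := run_EPI (P := SIMF M k MB kB) (O := O) (ρ := ρ')
    cEPI hpc₂ (fun a => by have := hrel₂.inv.memT a; omega) hpre₂.1 h40 (by omega)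
  refine ⟨n₁ + (n₂ + n₃), c', run_add_of_run _ _ _ _ r₁ (run_add_of_run _ _ _ _ r₂ r₃), hpc₃, ?_, ?_, ?_⟩
  · simp only [readOut, h0]
    refine readSeg_congr fun j hj => ?_
    rw [hout (1 + j) (by omega) (by omega), show 40 + (1 + j) = 40 + (1 + j) from rfl]
    have := hrel₂.agree (1 + j) (by simp only [EM_Q]; omega)
    rwa [edec_M_eq hrel₂.inv.stamp (by omega)] at this
  · rw [hq₃, hq₂]
  · simp only [simCost, readOut_length, List.map_nil, List.sum_nil, Nat.add_zero, init_queries] at hcost₂ ⊢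
    have := Nat.mul_le_mul_left cstep hnM
    omega

/-- **The composed reduction as a halting certificate**: for every `T ≥ simCost …` it halts within
`T` steps (run with the `D`-oracle `O`) in a configuration whose output is the output of the outer
reduction and whose query log is the concatenation of the `D`-query logs of the inline runs.
[folklore] -/
theorem haltsWithin_SIMF (hdet : M.IsDeterministic) (hBdet : MB.IsDeterministic)
    {x : List ℕ} (hw : inputWidth x ≤ W) (hk : k * inputWidth x < W)
    (hL : x.length + 83 ≤ Qv W)
    (hMV : Program.maxConst M ≤ V) (hV1 : 1 ≤ V) (hwsV : 2 ^ (k * inputWidth x) - 1 ≤ V)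
    (hVQ : 2 * V + 121 ≤ Qv W - 40)
    (hkB : kB * Nat.size V < W) (hVB : 2 ^ (kB * Nat.size V) ≤ VB) (hMBc : Program.maxConst MB ≤ VB)
    (hVBQ : 2 * VB + 2 ≤ Qv W)
    {O OB : List ℕ → List ℕ} {t : ℕ} {cM : Cfg} (hM : HaltsWithin M (k * inputWidth x) OB zeroCoins x t cM)
    (ht : t + 2 ≤ 2 ^ W) (hO : ∀ q ∈ cM.queries, (OB q).length ≤ V) {s : List ℕ → ℕ}
    {Dq : List ℕ → List (List ℕ)}
    (hMB : ∀ q ∈ cM.queries, ∃ cB, HaltsWithin MB (kB * inputWidth q) O zeroCoins q (s q) cB ∧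
      readOut cB.mem = OB q ∧ cB.queries = Dq q ∧ ∀ q' ∈ cB.queries, (O q').length ≤ VB)
    (ρ' : ℕ → ℕ) {T : ℕ}
    (hT : simCost x.length W t ((cM.queries.map (chargeB W O OB s Dq)).sum) (readOut cM.mem).length ≤ T) :
    ∃ c', HaltsWithin (SIMF M k MB kB) W O ρ' x T c' ∧ readOut c'.mem = readOut cM.mem ∧
      c'.queries = (cM.queries.map Dq).flatten := by
  obtain ⟨n, c', hrun, hpc, hout, hq, hn⟩ := run_SIMF hdet hBdet hw hk hL hMV hV1 hwsV hVQ hkB hVB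
    hMBc hVBQ hM ht hO hMB ρ'
  exact ⟨c', haltsWithin_of_run hrun ((step_eq_none_iff _ _ _ _ _).2 hpc) (hn.trans hT), hout, hq⟩

end sim

end Inline

end Literature.Computability.Cryptography.WordRAM
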